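import Literature.MathematicalPhysics.QuantumLattice.LiebMattisMatrixElements
import Literature.MathematicalPhysics.QuantumLattice.XYZGroundStateOrder
import HarnessLib

/-!
# A plaquette variational bound for the anisotropic spin-½ model on the even square torus

Topic `MathematicalPhysics/QuantumLattice`; fourth sibling proof file of `XYZGroundStateOrder.lean`.
The Björnberg–Ueltschi / Kennedy–Lieb–Shastry argument for ground-state planar order of the
spin-½ model `H₀ = -Σ_x Σ_{y∼x}(J₁SˣSˣ + J₂SʸSʸ + SᶻSᶻ)` on `(ℤ/Lℤ)²` (formalised in
`XYZGroundStateOrderProofs.lean`) consumes a LOWER bound on the energy combination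
`ε = c⁰ + J₂c¹ + J₁c² = -E₀/(4L²)`; B–U use the fully polarised state, `ε ≥ ¼`
(`xyz_polarised_bound`), which gives the printed spin-½ window `-J₂/J₁ ≤ 0.109`.
Kubo–Kishi (PRL 61 (1988) 2585) and Wischmann–Müller-Hartmann (J. Phys. I 1 (1991) 647) enlarged the
window by better energy estimates. Here we certify the simplest such improvement: the product over
the `2 × 2` plaquettes of `(ℤ/2kℤ)²` of the plaquette state
`φ = |↑↑↑↑⟩ + (1/10) Σ_{4 bonds} |↓↓ on the bond⟩ + (1/50) Σ_{2 diagonals} |↓↓⟩ + (3/100) |↓↓↓↓⟩`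
(a rational point next to the cluster-mean-field optimum) has, by the variational principle,
`ε ≥ ½ (535 J₁/10417 - 495 J₂/10417 + 10001/41668 + (9991/20834)²)` (`xyz_plaquette_bound`),
which is `0.2607 + 0.0238ρ` on the slice `J₁ = 1, J₂ = -ρ` (against `¼`), enough for the window
`ρ ≤ 0.15` (`XYZGroundStateOrderWindow.lean`).

Contents of this file (part 1 of 2): the `2`-adic splitting `ℤ/2kℤ ≃ ℤ/kℤ × {0,1}` and the
induced plaquette decomposition `(ℤ/2kℤ)² ≃ (ℤ/kℤ)² × {0,1}²` with its nearest-neighbour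
bookkeeping; the plaquette state `φ` and its (brute-force) norm, one- and two-point expectation
values. Part 2 (`XYZGroundStateOrderPlaquetteEnergy.lean`): the energy of the plaquette product
state (`BlockProductStates.lean`) and the bound `xyz_plaquette_bound`. Standard material (cluster
mean-field / Anderson-type variational bounds); no statement of the tree is changed.
-/

noncomputable section

open Matrix Complex Finset
open Literature.MathematicalPhysics.QuantumLattice.SpinOperators Literature.Probability.LatticeModels

namespace Literature.MathematicalPhysics.QuantumLattice

/-! ### The `2`-adic splitting of an even cycle -/

section ZModDouble

variable (k : ℕ)

/-- The plaquette coordinate `⌊z/2⌋ ∈ ℤ/kℤ` of `z ∈ ℤ/2kℤ`. [folklore] -/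
def zmodHalf (z : ZMod (2 * k)) : ZMod k := ((z.val / 2 : ℕ) : ZMod k)

/-- The parity `z mod 2 ∈ {0,1}` of `z ∈ ℤ/2kℤ` (the position inside the plaquette). [folklore] -/
def zmodParity (z : ZMod (2 * k)) : Fin 2 := ⟨z.val % 2, Nat.mod_lt _ two_pos⟩

/-- Gluing a plaquette coordinate `b ∈ ℤ/kℤ` and a parity `a` to `2b + a ∈ ℤ/2kℤ`. [folklore] -/
def zmodGlue (b : ZMod k) (a : Fin 2) : ZMod (2 * k) := ((2 * b.val + a.val : ℕ) : ZMod (2 * k))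

variable {k} [NeZero k]

/-- `2 ⌊z/2⌋ + (z mod 2) = z`. [folklore] -/
theorem zmodGlue_half_parity (z : ZMod (2 * k)) : zmodGlue k (zmodHalf k z) (zmodParity k z) = z := by
  haveI : NeZero (2 * k) := ⟨by have := NeZero.ne k; omega⟩
  have hz : z.val < 2 * k := ZMod.val_lt z
  have h1 : (zmodHalf k z).val = z.val / 2 := by
    rw [zmodHalf, ZMod.val_cast_of_lt (by omega)]
  simp only [zmodGlue, h1, zmodParity]
  rw [Nat.div_add_mod, ZMod.natCast_zmod_val]

/-- The value of the glued coordinate. [folklore] -/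
theorem val_zmodGlue (b : ZMod k) (a : Fin 2) : (zmodGlue k b a).val = 2 * b.val + a.val := by
  haveI : NeZero (2 * k) := ⟨by have := NeZero.ne k; omega⟩
  have hb : b.val < k := ZMod.val_lt b
  have ha : a.val < 2 := a.isLt
  rw [zmodGlue, ZMod.val_cast_of_lt (by omega)]

/-- `⌊(2b + a)/2⌋ = b`. [folklore] -/
theorem zmodHalf_glue (b : ZMod k) (a : Fin 2) : zmodHalf k (zmodGlue k b a) = b := by
  have ha : a.val < 2 := a.isLt
  rw [zmodHalf, val_zmodGlue, show (2 * b.val + a.val) / 2 = b.val by omega, ZMod.natCast_zmod_val]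

/-- `(2b + a) mod 2 = a`. [folklore] -/
theorem zmodParity_glue (b : ZMod k) (a : Fin 2) : zmodParity k (zmodGlue k b a) = a := by
  have ha : a.val < 2 := a.isLt
  apply Fin.ext
  simp only [zmodParity, val_zmodGlue]
  omega

omit [NeZero k] in
/-- `(2b + 0) + 1 = 2b + 1`. [folklore] -/
theorem zmodGlue_zero_add_one (b : ZMod k) : zmodGlue k b 0 + 1 = zmodGlue k b 1 := by
  simp only [zmodGlue, Fin.val_zero, Fin.val_one, add_zero]
  push_cast
  ring

/-- `(2b + 1) + 1 = 2(b + 1) + 0` in `ℤ/2kℤ` (the carry). [folklore] -/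
theorem zmodGlue_one_add_one (b : ZMod k) : zmodGlue k b 1 + 1 = zmodGlue k (b + 1) 0 := by
  simp only [zmodGlue, Fin.val_zero, Fin.val_one, add_zero]
  have hmod : (b + 1).val ≡ b.val + 1 [MOD k] := by
    rw [← ZMod.natCast_eq_natCast_iff]
    rw [ZMod.natCast_zmod_val]
    push_cast
    rw [ZMod.natCast_zmod_val]
  have h2 : 2 * (b + 1).val ≡ 2 * (b.val + 1) [MOD 2 * k] := Nat.ModEq.mul_left' 2 hmod
  rw [(ZMod.natCast_eq_natCast_iff _ _ _).2 h2]
  push_cast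
  ring

omit [NeZero k] in
/-- `(2b + 1) - 1 = 2b + 0`. [folklore] -/
theorem zmodGlue_one_sub_one (b : ZMod k) : zmodGlue k b 1 - 1 = zmodGlue k b 0 := by
  rw [sub_eq_iff_eq_add, zmodGlue_zero_add_one]

/-- `(2b + 0) - 1 = 2(b - 1) + 1` in `ℤ/2kℤ` (the borrow). [folklore] -/
theorem zmodGlue_zero_sub_one (b : ZMod k) : zmodGlue k b 0 - 1 = zmodGlue k (b - 1) 1 := by
  rw [sub_eq_iff_eq_add, zmodGlue_one_add_one, sub_add_cancel]

end ZModDouble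

/-! ### The plaquette decomposition of the even square torus -/

section Plaquettes

variable (k : ℕ) [NeZero k]

/-- **The plaquette decomposition** `(ℤ/2kℤ)² ≃ (ℤ/kℤ)² × {0,1}²`: a site `x` is (its plaquette
`⌊x/2⌋`, its position `x mod 2` inside the plaquette). [folklore] -/
def plaquetteEquiv : TorusSite 2 (2 * k) ≃ TorusSite 2 k × (Fin 2 → Fin 2) where
  toFun x := (fun i => zmodHalf k (x i), fun i => zmodParity k (x i))
  invFun p := fun i => zmodGlue k (p.1 i) (p.2 i)
  left_inv x := by
    funext i
    exact zmodGlue_half_parity (x i)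
  right_inv p := by
    refine Prod.ext (funext fun i => ?_) (funext fun i => ?_)
    · exact zmodHalf_glue (p.1 i) (p.2 i)
    · exact zmodParity_glue (p.1 i) (p.2 i)

/-- A site is glued from its plaquette and its position. [folklore] -/
theorem plaquetteEquiv_symm_apply (p : TorusSite 2 k × (Fin 2 → Fin 2)) (i : Fin 2) :
    (plaquetteEquiv k).symm p i = zmodGlue k (p.1 i) (p.2 i) := rfl

variable {k}

/-- **The neighbour `x + eᵢ`**: inside the same plaquette (position `i ↦ 1`) if `xᵢ` is even, in the
next plaquette `⌊x/2⌋ + eᵢ` (position `i ↦ 0`) if `xᵢ` is odd. [folklore] -/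
theorem plaquetteEquiv_add_single (x : TorusSite 2 (2 * k)) (i : Fin 2) :
    plaquetteEquiv k (x + Pi.single i 1) =
      if (plaquetteEquiv k x).2 i = 0 then
        ((plaquetteEquiv k x).1, Function.update (plaquetteEquiv k x).2 i 1)
      else ((plaquetteEquiv k x).1 + Pi.single i 1, Function.update (plaquetteEquiv k x).2 i 0) := by
  set b := (plaquetteEquiv k x).1 with hb
  set f := (plaquetteEquiv k x).2 with hf
  have hx : x = (plaquetteEquiv k).symm (b, f) := by
    rw [hb, hf, Prod.mk.eta, Equiv.symm_apply_apply]
  have h2 : ∀ a : Fin 2, a = 0 ∨ a = 1 := by decide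
  -- the shifted site, glued
  have key : x + Pi.single i 1 = (plaquetteEquiv k).symm
      (if f i = 0 then (b, Function.update f i 1) else (b + Pi.single i 1, Function.update f i 0)) := by
    funext j
    rw [hx]
    rcases h2 (f i) with h0 | h1
    · rw [if_pos h0]
      simp only [Pi.add_apply, plaquetteEquiv_symm_apply]
      by_cases hj : j = i
      · subst hj
        rw [Pi.single_eq_same, Function.update_self, h0, zmodGlue_zero_add_one]
      · rw [Pi.single_eq_of_ne hj, add_zero, Function.update_of_ne hj]
    · rw [if_neg (by rw [h1]; decide)]
      simp only [Pi.add_apply, plaquetteEquiv_symm_apply]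
      by_cases hj : j = i
      · subst hj
        rw [Pi.single_eq_same, Pi.single_eq_same, Function.update_self, h1, zmodGlue_one_add_one]
      · rw [Pi.single_eq_of_ne hj, Pi.single_eq_of_ne hj, add_zero, add_zero, Function.update_of_ne hj]
  rw [key, Equiv.apply_symm_apply]

/-- **The neighbour `x - eᵢ`**: inside the same plaquette (position `i ↦ 0`) if `xᵢ` is odd, in the
previous plaquette `⌊x/2⌋ - eᵢ` (position `i ↦ 1`) if `xᵢ` is even. [folklore] -/
theorem plaquetteEquiv_sub_single (x : TorusSite 2 (2 * k)) (i : Fin 2) :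
    plaquetteEquiv k (x - Pi.single i 1) =
      if (plaquetteEquiv k x).2 i = 0 then
        ((plaquetteEquiv k x).1 - Pi.single i 1, Function.update (plaquetteEquiv k x).2 i 1)
      else ((plaquetteEquiv k x).1, Function.update (plaquetteEquiv k x).2 i 0) := by
  set b := (plaquetteEquiv k x).1 with hb
  set f := (plaquetteEquiv k x).2 with hf
  have hx : x = (plaquetteEquiv k).symm (b, f) := by
    rw [hb, hf, Prod.mk.eta, Equiv.symm_apply_apply]
  have h2 : ∀ a : Fin 2, a = 0 ∨ a = 1 := by decide
  have key : x - Pi.single i 1 = (plaquetteEquiv k).symm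
      (if f i = 0 then (b - Pi.single i 1, Function.update f i 1) else (b, Function.update f i 0)) := by
    funext j
    rw [hx]
    rcases h2 (f i) with h0 | h1
    · rw [if_pos h0]
      simp only [Pi.sub_apply, plaquetteEquiv_symm_apply]
      by_cases hj : j = i
      · subst hj
        rw [Pi.single_eq_same, Pi.single_eq_same, Function.update_self, h0, zmodGlue_zero_sub_one]
      · rw [Pi.single_eq_of_ne hj, Pi.single_eq_of_ne hj, sub_zero, sub_zero, Function.update_of_ne hj]
    · rw [if_neg (by rw [h1]; decide)]
      simp only [Pi.sub_apply, plaquetteEquiv_symm_apply]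
      by_cases hj : j = i
      · subst hj
        rw [Pi.single_eq_same, Function.update_self, h1, zmodGlue_one_sub_one]
      · rw [Pi.single_eq_of_ne hj, sub_zero, Function.update_of_ne hj]
  rw [key, Equiv.apply_symm_apply]

omit [NeZero k] in
/-- For `k ≥ 2` the plaquettes `b` and `b ± eᵢ` are distinct. [folklore] -/
theorem ne_add_single_of_two_le (hk : 2 ≤ k) (b : TorusSite 2 k) (i : Fin 2) :
    b ≠ b + Pi.single i 1 ∧ b ≠ b - Pi.single i 1 := by
  haveI : Fact (1 < k) := ⟨by omega⟩
  have h1 : (1 : ZMod k) ≠ 0 := one_ne_zero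
  constructor
  · intro h
    have := congrFun h i
    simp only [Pi.add_apply, Pi.single_eq_same] at this
    exact h1 (by linear_combination (this : b i = b i + 1).symm)
  · intro h
    have := congrFun h i
    simp only [Pi.sub_apply, Pi.single_eq_same] at this
    exact h1 (by linear_combination (this : b i = b i - 1))

end Plaquettes

/-! ### The plaquette trial state -/

section PlaquetteState

/-- Amplitude table of the plaquette state, indexed by the spin values (`0 = ↑`, `1 = ↓`) at the
positions `(0,0), (1,0), (0,1), (1,1)`: `1` on `↑↑↑↑`, `1/10` on the four nearest-neighbour pairs of
down spins, `1/50` on the two diagonal pairs, `3/100` on `↓↓↓↓`, `0` otherwise. [folklore] -/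
def plaquetteTable : Fin 2 → Fin 2 → Fin 2 → Fin 2 → ℂ :=
  fun a b c d => ![![![![(1 : ℂ), 0], ![0, 1/10]], ![![0, 1/10], ![1/50, 0]]],
    ![![![0, 1/50], ![1/10, 0]], ![![1/10, 0], ![0, 3/100]]]] a b c d

/-- **The plaquette state** `φ` on the `2 × 2` block `{0,1}²` (local dimension `2`, i.e. spin ½).
[folklore] -/
def plaquetteState : TensorIndex (Fin 2 → Fin 2) 2 → ℂ :=
  fun σ => plaquetteTable (σ ![0, 0]) (σ ![1, 0]) (σ ![0, 1]) (σ ![1, 1])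

/-- A position `f ∈ {0,1}²` is the vector of its two coordinates. [folklore] -/
theorem fin_two_fun_eq (f : Fin 2 → Fin 2) : f = ![f 0, f 1] := by
  funext j; fin_cases j <;> rfl

/-- Equality of positions is equality of coordinates. [folklore] -/
theorem vecTwo_eq_iff (a b c d : Fin 2) : (![a, b] : Fin 2 → Fin 2) = ![c, d] ↔ a = c ∧ b = d := by
  constructor
  · intro h
    exact ⟨by simpa using congrFun h 0, by simpa using congrFun h 1⟩
  · rintro ⟨rfl, rfl⟩
    rfl

/-- Block configurations as quadruples of spin values. [folklore] -/
def plaquetteCfgEquiv : TensorIndex (Fin 2 → Fin 2) 2 ≃ Fin 2 × Fin 2 × Fin 2 × Fin 2 where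
  toFun σ := (σ ![0, 0], σ ![1, 0], σ ![0, 1], σ ![1, 1])
  invFun p := fun f => ![![p.1, p.2.2.1], ![p.2.1, p.2.2.2]] (f 0) (f 1)
  left_inv σ := by
    funext f
    have h2 : ∀ a : Fin 2, a = 0 ∨ a = 1 := by decide
    rw [fin_two_fun_eq f]
    rcases h2 (f 0) with h0 | h0 <;> rcases h2 (f 1) with h1 | h1 <;> simp [h0, h1]
  right_inv p := by rfl

/-- Enumeration of the sixteen block configurations. [folklore] -/
theorem sum_plaquetteCfg (g : TensorIndex (Fin 2 → Fin 2) 2 → ℂ) :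
    ∑ σ, g σ = ∑ a : Fin 2, ∑ b : Fin 2, ∑ c : Fin 2, ∑ d : Fin 2,
      g (fun f => ![![a, c], ![b, d]] (f 0) (f 1)) := by
  rw [← plaquetteCfgEquiv.symm.sum_comp]
  simp only [Fintype.sum_prod_type]
  rfl

/-- `⟨φ, φ⟩ = 10417/10000`. [folklore] -/
theorem plaquetteState_norm : star plaquetteState ⬝ᵥ plaquetteState = (10417 / 10000 : ℂ) := by
  simp only [dotProduct, Pi.star_apply, sum_plaquetteCfg, Fin.sum_univ_two]
  simp [plaquetteState, plaquetteTable]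
  norm_num

/-- The `fin_cases` normal form of `2 : Fin 3`. [folklore] -/
theorem fin_three_mk_two (h : 2 < 3) : (⟨2, h⟩ : Fin 3) = 2 := rfl

/-- `σ⁰ = σˣ`. [folklore] -/
theorem spinHalfPauli_zero : spinHalfPauli 0 = !![0, 1; 1, 0] := rfl

/-- `σ¹ = σʸ`. [folklore] -/
theorem spinHalfPauli_one : spinHalfPauli 1 = !![0, -I; I, 0] := rfl

/-- `σ² = σᶻ`. [folklore] -/
theorem spinHalfPauli_two : spinHalfPauli 2 = !![1, 0; 0, -1] := rfl

/-- The one-point values of `φ`: `⟨φ, Sˣ φ⟩ = ⟨φ, Sʸ φ⟩ = 0`, `⟨φ, Sᶻ φ⟩ = 9991/20000`. [folklore] -/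
def plaquetteMagVal : Fin 3 → ℂ := ![0, 0, 9991 / 20000]

/-- `⟨Sˣ⟩_φ = 0`. [folklore] -/
theorem plaquetteMagVal_zero : plaquetteMagVal 0 = 0 := rfl

/-- `⟨Sʸ⟩_φ = 0`. [folklore] -/
theorem plaquetteMagVal_one : plaquetteMagVal 1 = 0 := rfl

/-- `⟨Sᶻ⟩_φ = 9991/20000`. [folklore] -/
theorem plaquetteMagVal_two : plaquetteMagVal 2 = 9991 / 20000 := rfl

/-- **One-point functions of `φ`**: `⟨φ, Sᶻ_f φ⟩ = 9991/20000` and `⟨φ, Sˣ_f φ⟩ = ⟨φ, Sʸ_f φ⟩ = 0`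
at every position `f`. [folklore] -/
theorem plaquetteState_onePoint (a b : Fin 2) (α : Fin 3) :
    star plaquetteState ⬝ᵥ (onSite ![a, b] (spinVec 1 α) *ᵥ plaquetteState) = plaquetteMagVal α := by
  fin_cases a <;> fin_cases b <;> fin_cases α <;>
  · simp only [Fin.zero_eta, Fin.mk_one, fin_three_mk_two, Fin.isValue, dotProduct, Pi.star_apply,
      LiebMattis.onSite_mulVec_apply, sum_plaquetteCfg, Fin.sum_univ_two, spinVec_one_eq_half_spinHalfPauli,
      spinHalfPauli_zero, spinHalfPauli_one, spinHalfPauli_two, plaquetteMagVal_zero, plaquetteMagVal_one,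
      plaquetteMagVal_two]
    simp only [plaquetteState, Function.update_apply, vecTwo_eq_iff, Matrix.cons_val_zero, Matrix.cons_val_one]
    norm_num [plaquetteTable, Complex.ext_iff]

/-- The nearest-neighbour two-point values of `φ` for the three spin components:
`⟨φ, SˣSˣ φ⟩ = 107/2000`, `⟨φ, SʸSʸ φ⟩ = -99/2000`, `⟨φ, SᶻSᶻ φ⟩ = 10001/40000`. [folklore] -/
def plaquettePairVal : Fin 3 → ℂ := ![107 / 2000, -99 / 2000, 10001 / 40000]

/-- `⟨SˣSˣ⟩_φ = 107/2000` on a bond. [folklore] -/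
theorem plaquettePairVal_zero : plaquettePairVal 0 = 107 / 2000 := rfl

/-- `⟨SʸSʸ⟩_φ = -99/2000` on a bond. [folklore] -/
theorem plaquettePairVal_one : plaquettePairVal 1 = -99 / 2000 := rfl

/-- `⟨SᶻSᶻ⟩_φ = 10001/40000` on a bond. [folklore] -/
theorem plaquettePairVal_two : plaquettePairVal 2 = 10001 / 40000 := rfl

/-- Updating the first coordinate of a position. [folklore] -/
theorem update_vecTwo_zero (a b c : Fin 2) : Function.update ![a, b] 0 c = ![c, b] := by
  funext j; fin_cases j <;> simp

/-- Updating the second coordinate of a position. [folklore] -/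
theorem update_vecTwo_one (a b c : Fin 2) : Function.update ![a, b] 1 c = ![a, c] := by
  funext j; fin_cases j <;> simp

/-- `a + 1` in `Fin 2`: `0 + 1 = 1`, `1 + 1 = 0`. [folklore] -/
theorem fin_two_add_one (a : Fin 2) : a + 1 = ![(1 : Fin 2), 0] a := by
  fin_cases a <;> decide

/-- Nearest-neighbour `SˣSˣ` two-point function of `φ`: `107/2000` on every bond, i.e. for every
position `f = (a,b)` and direction `i`, with `f'` differing from `f` in coordinate `i`. [folklore] -/
theorem plaquetteState_twoPoint_x (a b : Fin 2) (i : Fin 2) :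
    star plaquetteState ⬝ᵥ (onSite ![a, b] (spinVec 1 0) *ᵥ
      (onSite (Function.update ![a, b] i (![a, b] i + 1)) (spinVec 1 0) *ᵥ plaquetteState)) = 107 / 2000 := by
  fin_cases a <;> fin_cases b <;> fin_cases i <;>
  · simp only [Fin.zero_eta, Fin.mk_one, Fin.isValue, update_vecTwo_zero, update_vecTwo_one,
      Matrix.cons_val_zero, Matrix.cons_val_one, fin_two_add_one]
    simp only [dotProduct, Pi.star_apply, LiebMattis.onSite_mulVec_apply, sum_plaquetteCfg,
      Fin.sum_univ_two, spinVec_one_eq_half_spinHalfPauli, spinHalfPauli_zero]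
    simp only [plaquetteState, Function.update_apply, vecTwo_eq_iff, Matrix.cons_val_zero, Matrix.cons_val_one]
    norm_num [plaquetteTable]

/-- Nearest-neighbour `SʸSʸ` two-point function of `φ`: `-99/2000` on every bond. [folklore] -/
theorem plaquetteState_twoPoint_y (a b : Fin 2) (i : Fin 2) :
    star plaquetteState ⬝ᵥ (onSite ![a, b] (spinVec 1 1) *ᵥ
      (onSite (Function.update ![a, b] i (![a, b] i + 1)) (spinVec 1 1) *ᵥ plaquetteState)) = -99 / 2000 := by
  fin_cases a <;> fin_cases b <;> fin_cases i <;>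
  · simp only [Fin.zero_eta, Fin.mk_one, Fin.isValue, update_vecTwo_zero, update_vecTwo_one,
      Matrix.cons_val_zero, Matrix.cons_val_one, fin_two_add_one]
    simp only [dotProduct, Pi.star_apply, LiebMattis.onSite_mulVec_apply, sum_plaquetteCfg,
      Fin.sum_univ_two, spinVec_one_eq_half_spinHalfPauli, spinHalfPauli_one]
    simp only [plaquetteState, Function.update_apply, vecTwo_eq_iff, Matrix.cons_val_zero, Matrix.cons_val_one]
    norm_num [plaquetteTable, Complex.ext_iff]

/-- Nearest-neighbour `SᶻSᶻ` two-point function of `φ`: `10001/40000` on every bond. [folklore] -/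
theorem plaquetteState_twoPoint_z (a b : Fin 2) (i : Fin 2) :
    star plaquetteState ⬝ᵥ (onSite ![a, b] (spinVec 1 2) *ᵥ
      (onSite (Function.update ![a, b] i (![a, b] i + 1)) (spinVec 1 2) *ᵥ plaquetteState)) = 10001 / 40000 := by
  fin_cases a <;> fin_cases b <;> fin_cases i <;>
  · simp only [Fin.zero_eta, Fin.mk_one, Fin.isValue, update_vecTwo_zero, update_vecTwo_one,
      Matrix.cons_val_zero, Matrix.cons_val_one, fin_two_add_one]
    simp only [dotProduct, Pi.star_apply, LiebMattis.onSite_mulVec_apply, sum_plaquetteCfg,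
      Fin.sum_univ_two, spinVec_one_eq_half_spinHalfPauli, spinHalfPauli_two]
    simp only [plaquetteState, Function.update_apply, vecTwo_eq_iff, Matrix.cons_val_zero, Matrix.cons_val_one]
    norm_num [plaquetteTable]

/-- **Nearest-neighbour two-point functions of `φ`**: for every position `f = (a,b)`, direction `i`
and spin component `α`, with `f'` the position differing from `f` in coordinate `i`,
`⟨φ, Sᵅ_f Sᵅ_{f'} φ⟩ = plaquettePairVal α`. [folklore] -/
theorem plaquetteState_twoPoint (a b : Fin 2) (i : Fin 2) (α : Fin 3) :
    star plaquetteState ⬝ᵥ (onSite ![a, b] (spinVec 1 α) *ᵥ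
      (onSite (Function.update ![a, b] i (![a, b] i + 1)) (spinVec 1 α) *ᵥ plaquetteState)) =
      plaquettePairVal α := by
  fin_cases α
  · exact plaquetteState_twoPoint_x a b i
  · exact plaquetteState_twoPoint_y a b i
  · exact plaquetteState_twoPoint_z a b i

/-- One-point functions of `φ` at an updated position (both coordinates of the partner are read
off after the update). [folklore] -/
theorem plaquetteState_onePoint_update (a b : Fin 2) (i : Fin 2) (c : Fin 2) (α : Fin 3) :
    star plaquetteState ⬝ᵥ (onSite (Function.update ![a, b] i c) (spinVec 1 α) *ᵥ plaquetteState) =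
      plaquetteMagVal α := by
  fin_cases i
  · simp only [Fin.zero_eta, Fin.isValue, update_vecTwo_zero]
    exact plaquetteState_onePoint c b α
  · simp only [Fin.mk_one, Fin.isValue, update_vecTwo_one]
    exact plaquetteState_onePoint a c α

end PlaquetteState

end Literature.MathematicalPhysics.QuantumLattice

end
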